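import Summits.FinalStateConjecture.FinalStateConjecture.Theses.PhotonSphereChannels
import Summits.FinalStateConjecture.FinalStateConjecture.Theorems.PhotonSphereChannelsExteriorEnergyRW

/-!
# Crux `WindowedShellChannels` (stmt-FinalStateConjecture-14085), line `SketchIdeator3` — stub `stub_parity`

Parity regrading `W_even ∧ W_odd → W` (port of ideator 3's kernel-checked `parityTransfer_mpr`).

For a global `C²` solution `ψ` of `ψ_tt − ψ_xx + Vψ = 0` and reals `a, b`, the time-parity
combination `ψ_{a,b}(t, x) = a ψ(t, x) + b ψ(−t, x)` is again a solution whose Cauchy data vanish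
wherever those of `ψ` do; `(a, b) = (½, ½)` is the even (standing-start) part `ψ_e`, `(½, −½)` the
odd (pure-kick) part `ψ_o`, `(0, 1)` the time reflection.  Parallelogram law:
`e[ψ](t) + e[ψ](−t) = 2e[ψ_e](t) + 2e[ψ_o](t)` pointwise, hence for the exterior energies of EVERY
aperture (time reversal preserves the region `{a + |t| < |x − xc|}`) and, at `t = 0`,
`E(ψ) = E(ψ_e) + E(ψ_o)` (helper lemmas in the sub-namespace `Parity`).  Exterior energies of a
solution (`V ≥ 0` differentiable) converge as `t → ±∞` for every aperture, lagged apertures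
`a < 0` included (time shift `ψ(· − a, ·)` + the landed `RW.exteriorEnergy_antitoneOn` at aperture
`0`), so
`ch⁺(ψ) + ch⁻(ψ) = 2ch⁺(ψ_e) + 2ch⁺(ψ_o)`.  With `h := max h_e h_o`, `c := 2 min c_e c_o` and the
aperture monotonicity of channel energies, the one-ended parity statements give the two-ended crux.
No definitions: the parity parts are the literal lambdas `fun t x => a * ψ t x + b * ψ (-t) x`.
-/

noncomputable section

set_option linter.dupNamespace false

namespace Summit.FinalStateConjecture.FinalStateConjecture.Theorems.WindowedShellChannelsStubs

open Literature.Geometry.Lorentzian Literature.Geometry.Lorentzian.ReggeWheeler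
open Summit.FinalStateConjecture.FinalStateConjecture.Theses.PhotonSphereChannels
open Filter Set MeasureTheory
open scoped ENNReal Topology

namespace Parity

section ParityCalculus

variable {V : ℝ → ℝ} {ψ : ℝ → ℝ → ℝ}

/-- `t`-slices of a `C²` function of `(t, x)` are `C²`. -/
theorem contDiff_slice_fst (hψ : ContDiff ℝ 2 (Function.uncurry ψ)) (x : ℝ) :
    ContDiff ℝ 2 (fun τ => ψ τ x) :=
  hψ.comp (contDiff_id.prodMk contDiff_const)

/-- `x`-slices of a `C²` function of `(t, x)` are `C²`. -/
theorem contDiff_slice_snd (hψ : ContDiff ℝ 2 (Function.uncurry ψ)) (t : ℝ) :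
    ContDiff ℝ 2 (ψ t) :=
  hψ.comp (contDiff_const.prodMk contDiff_id)

/-- Reflected `t`-slices `τ ↦ ψ(−τ, x)` of a `C²` function are `C²`. -/
theorem contDiff_slice_fst_reflect (hψ : ContDiff ℝ 2 (Function.uncurry ψ)) (x : ℝ) :
    ContDiff ℝ 2 (fun τ => ψ (-τ) x) :=
  (contDiff_slice_fst hψ x).comp contDiff_neg

/-- The parity combination `a ψ(t, x) + b ψ(−t, x)` of a `C²` function is `C²`. -/
theorem contDiff_uncurry_comb (hψ : ContDiff ℝ 2 (Function.uncurry ψ)) (a b : ℝ) :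
    ContDiff ℝ 2 (Function.uncurry fun t x => a * ψ t x + b * ψ (-t) x) :=
  (contDiff_const.mul hψ).add
    (contDiff_const.mul (hψ.comp (contDiff_fst.neg.prodMk contDiff_snd)))

/-- `∂_t` of the parity combination. -/
theorem deriv_comb_fst (hψ : ContDiff ℝ 2 (Function.uncurry ψ)) (a b t x : ℝ) :
    deriv (fun τ => a * ψ τ x + b * ψ (-τ) x) t
      = a * deriv (fun τ => ψ τ x) t - b * deriv (fun τ => ψ τ x) (-t) := by
  have hf := (contDiff_slice_fst hψ x).differentiable (by norm_num)
  have hg := (contDiff_slice_fst_reflect hψ x).differentiable (by norm_num)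
  rw [deriv_fun_add ((hf t).const_mul a) ((hg t).const_mul b), deriv_const_mul_field,
    deriv_const_mul_field, deriv_comp_neg (fun τ => ψ τ x) t]
  ring

/-- `∂_x` of the parity combination. -/
theorem deriv_comb_snd (hψ : ContDiff ℝ 2 (Function.uncurry ψ)) (a b t x : ℝ) :
    deriv (fun y => a * ψ t y + b * ψ (-t) y) x = a * deriv (ψ t) x + b * deriv (ψ (-t)) x := by
  have hf := (contDiff_slice_snd hψ t).differentiable (by norm_num)
  have hg := (contDiff_slice_snd hψ (-t)).differentiable (by norm_num)
  rw [deriv_fun_add ((hf x).const_mul a) ((hg x).const_mul b), deriv_const_mul_field,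
    deriv_const_mul_field]

/-- `∂_t²` of the parity combination. -/
theorem iteratedDeriv_comb_fst (hψ : ContDiff ℝ 2 (Function.uncurry ψ)) (a b t x : ℝ) :
    iteratedDeriv 2 (fun τ => a * ψ τ x + b * ψ (-τ) x) t
      = a * iteratedDeriv 2 (fun τ => ψ τ x) t + b * iteratedDeriv 2 (fun τ => ψ τ x) (-t) := by
  have h1 : ContDiffAt ℝ 2 (fun τ => a * ψ τ x) t :=
    (contDiff_const.mul (contDiff_slice_fst hψ x)).contDiffAt
  have h2 : ContDiffAt ℝ 2 (fun τ => b * ψ (-τ) x) t :=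
    (contDiff_const.mul (contDiff_slice_fst_reflect hψ x)).contDiffAt
  rw [iteratedDeriv_fun_add h1 h2, iteratedDeriv_const_mul_field, iteratedDeriv_const_mul_field,
    iteratedDeriv_comp_neg 2 (fun τ => ψ τ x) t]
  simp

/-- `∂_x²` of the parity combination. -/
theorem iteratedDeriv_comb_snd (hψ : ContDiff ℝ 2 (Function.uncurry ψ)) (a b t x : ℝ) :
    iteratedDeriv 2 (fun y => a * ψ t y + b * ψ (-t) y) x
      = a * iteratedDeriv 2 (ψ t) x + b * iteratedDeriv 2 (ψ (-t)) x := by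
  have h1 : ContDiffAt ℝ 2 (fun y => a * ψ t y) x :=
    (contDiff_const.mul (contDiff_slice_snd hψ t)).contDiffAt
  have h2 : ContDiffAt ℝ 2 (fun y => b * ψ (-t) y) x :=
    (contDiff_const.mul (contDiff_slice_snd hψ (-t))).contDiffAt
  rw [iteratedDeriv_fun_add h1 h2, iteratedDeriv_const_mul_field, iteratedDeriv_const_mul_field]

/-- The parity combination of a solution is a solution (`(½, ½)`: even part, data `(ψ₀, 0)`;
`(½, −½)`: odd part, data `(0, ψ₁)`; `(0, 1)`: time reflection). -/
theorem isSolution_comb (hψ : IsSolution V ψ) (a b : ℝ) :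
    IsSolution V (fun t x => a * ψ t x + b * ψ (-t) x) := by
  refine ⟨contDiff_uncurry_comb hψ.1 a b, fun z => ?_⟩
  obtain ⟨t, x⟩ := z
  have h1 := hψ.2 (t, x)
  have h2 := hψ.2 (-t, x)
  unfold IsSolutionAt at h1 h2 ⊢
  simp only at h1 h2 ⊢
  rw [iteratedDeriv_comb_fst hψ.1, iteratedDeriv_comb_snd hψ.1]
  linear_combination a * h1 + b * h2

/-- Cauchy data of the parity combination vanish wherever those of `ψ` do. -/
theorem supported_comb (hψ : ContDiff ℝ 2 (Function.uncurry ψ)) {S : Set ℝ}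
    (hsupp : CauchyDataSupportedOn ψ S) (a b : ℝ) :
    CauchyDataSupportedOn (fun t x => a * ψ t x + b * ψ (-t) x) S := by
  intro x hx
  obtain ⟨h0, h1⟩ := hsupp x hx
  refine ⟨?_, ?_⟩
  · show a * ψ 0 x + b * ψ (-0) x = 0
    rw [neg_zero, h0, mul_zero, mul_zero, add_zero]
  · show deriv (fun τ => a * ψ τ x + b * ψ (-τ) x) 0 = 0
    rw [deriv_comb_fst hψ, neg_zero, h1, mul_zero, mul_zero, sub_zero]

/-- The energy density of the parity combination in terms of `ψ`. -/
theorem energyDensity_comb (hψ : ContDiff ℝ 2 (Function.uncurry ψ)) (a b t x : ℝ) :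
    energyDensity V (fun t x => a * ψ t x + b * ψ (-t) x) t x
      = (a * deriv (fun τ => ψ τ x) t - b * deriv (fun τ => ψ τ x) (-t)) ^ 2
        + (a * deriv (ψ t) x + b * deriv (ψ (-t)) x) ^ 2
        + V x * (a * ψ t x + b * ψ (-t) x) ^ 2 := by
  simp only [energyDensity, deriv_comb_fst hψ, deriv_comb_snd hψ]

/-- Parallelogram law, pointwise: `e[ψ](t, x) + e[ψ](−t, x) = 2e[ψ_e](t, x) + 2e[ψ_o](t, x)`. -/
theorem energyDensity_parity_split (hψ : ContDiff ℝ 2 (Function.uncurry ψ)) (t x : ℝ) :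
    energyDensity V ψ t x + energyDensity V ψ (-t) x
      = 2 * energyDensity V (fun t x => 2⁻¹ * ψ t x + 2⁻¹ * ψ (-t) x) t x
        + 2 * energyDensity V (fun t x => 2⁻¹ * ψ t x + -2⁻¹ * ψ (-t) x) t x := by
  rw [energyDensity_comb hψ, energyDensity_comb hψ]
  unfold energyDensity
  ring

/-- The energy density of a `C²` function along a continuous potential is measurable in `x`
(it is continuous: the partials are values of the continuous Fréchet derivative). -/
theorem measurable_energyDensity (hV : Continuous V) (hψ : ContDiff ℝ 2 (Function.uncurry ψ))
    (t : ℝ) : Measurable fun x => ENNReal.ofReal (energyDensity V ψ t x) := by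
  have hp : Continuous fun x : ℝ => ((t, x) : ℝ × ℝ) := continuous_const.prodMk continuous_id
  have h1 : Continuous fun x => fderiv ℝ (Function.uncurry ψ) (t, x) (1, 0) :=
    (WaveEnergy.continuous_fderiv_apply hψ (1, 0)).comp hp
  have h2 : Continuous fun x => fderiv ℝ (Function.uncurry ψ) (t, x) (0, 1) :=
    (WaveEnergy.continuous_fderiv_apply hψ (0, 1)).comp hp
  have h3 : Continuous fun x => ψ t x := hψ.continuous.comp hp
  have heq : (fun x => energyDensity V ψ t x) = fun x =>
      (fderiv ℝ (Function.uncurry ψ) (t, x) (1, 0)) ^ 2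
        + (fderiv ℝ (Function.uncurry ψ) (t, x) (0, 1)) ^ 2 + V x * ψ t x ^ 2 := by
    funext x
    simp only [energyDensity, WaveEnergy.deriv_slice_fst_eq hψ, WaveEnergy.deriv_slice_snd_eq hψ]
  have hc : Continuous fun x => energyDensity V ψ t x := by
    rw [heq]
    exact ((h1.pow 2).add (h2.pow 2)).add (hV.mul (h3.pow 2))
  exact ENNReal.measurable_ofReal.comp hc.measurable

/-- Parity split of the exterior energies of EVERY aperture `a` (lagged ones included):
`E_a[ψ](t) + E_a[ψ](−t) = 2E_a[ψ_e](t) + 2E_a[ψ_o](t)`. -/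
theorem exteriorEnergy_parity_split (hV : Continuous V) (hV0 : ∀ x, 0 ≤ V x)
    (hψ : ContDiff ℝ 2 (Function.uncurry ψ)) (xc a t : ℝ) :
    exteriorEnergy V xc a ψ t + exteriorEnergy V xc a ψ (-t)
      = 2 * exteriorEnergy V xc a (fun t x => 2⁻¹ * ψ t x + 2⁻¹ * ψ (-t) x) t
        + 2 * exteriorEnergy V xc a (fun t x => 2⁻¹ * ψ t x + -2⁻¹ * ψ (-t) x) t := by
  unfold exteriorEnergy
  rw [abs_neg, ← lintegral_add_left (measurable_energyDensity hV hψ t),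
    ← lintegral_const_mul' _ _ (by simp), ← lintegral_const_mul' _ _ (by simp),
    ← lintegral_add_left
      ((measurable_energyDensity hV (contDiff_uncurry_comb hψ _ _) t).const_mul 2)]
  refine lintegral_congr fun x => ?_
  have he : 0 ≤ energyDensity V (fun t x => 2⁻¹ * ψ t x + 2⁻¹ * ψ (-t) x) t x :=
    energyDensity_nonneg _ _ (hV0 x)
  have ho : 0 ≤ energyDensity V (fun t x => 2⁻¹ * ψ t x + -2⁻¹ * ψ (-t) x) t x :=
    energyDensity_nonneg _ _ (hV0 x)
  rw [← ENNReal.ofReal_add (energyDensity_nonneg _ _ (hV0 x)) (energyDensity_nonneg _ _ (hV0 x)),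
    energyDensity_parity_split hψ, ENNReal.ofReal_add (by positivity) (by positivity),
    ENNReal.ofReal_mul zero_le_two, ENNReal.ofReal_mul zero_le_two, ENNReal.ofReal_ofNat]

/-- At `t = 0` the energy splits: `E(ψ) = E(ψ_e) + E(ψ_o)`. -/
theorem totalEnergy_zero_split (hV : Continuous V) (hV0 : ∀ x, 0 ≤ V x)
    (hψ : ContDiff ℝ 2 (Function.uncurry ψ)) :
    totalEnergy V ψ 0 = totalEnergy V (fun t x => 2⁻¹ * ψ t x + 2⁻¹ * ψ (-t) x) 0
      + totalEnergy V (fun t x => 2⁻¹ * ψ t x + -2⁻¹ * ψ (-t) x) 0 := by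
  unfold totalEnergy
  rw [← lintegral_add_left (measurable_energyDensity hV (contDiff_uncurry_comb hψ _ _) 0)]
  refine lintegral_congr fun x => ?_
  rw [← ENNReal.ofReal_add (energyDensity_nonneg _ _ (hV0 x)) (energyDensity_nonneg _ _ (hV0 x))]
  congr 1
  have h := energyDensity_parity_split (V := V) hψ 0 x
  rw [neg_zero] at h
  linarith

end ParityCalculus

/-! ### Convergence of exterior energies for every aperture; the channel form of the split -/

section Channels

variable {V : ℝ → ℝ} {ψ : ℝ → ℝ → ℝ}

/-- Time shifts `ψ(· + c, ·)` of a solution are solutions. -/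
theorem isSolution_tshift (hψ : IsSolution V ψ) (c : ℝ) :
    IsSolution V (fun t x => ψ (t + c) x) := by
  refine ⟨hψ.1.comp ((contDiff_fst.add contDiff_const).prodMk contDiff_snd), fun z => ?_⟩
  have h := hψ.2 (z.1 + c, z.2)
  have h1 : iteratedDeriv 2 (fun τ => ψ (τ + c) z.2) z.1
      = iteratedDeriv 2 (fun τ => ψ τ z.2) (z.1 + c) := by
    rw [iteratedDeriv_comp_add_const 2 (fun τ => ψ τ z.2) c]
  unfold IsSolutionAt at h ⊢
  simp only at h ⊢
  rw [h1]
  exact h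

/-- For `t ≥ 0`, `t + a ≥ 0` the exterior energy of aperture `a` at time `t` is the exterior energy
of aperture `0` at time `t + a` of the solution shifted in time by `−a`. -/
theorem exteriorEnergy_eq_tshift (V : ℝ → ℝ) (xc : ℝ) {a t : ℝ} (ht : 0 ≤ t) (hta : 0 ≤ t + a)
    (ψ : ℝ → ℝ → ℝ) :
    exteriorEnergy V xc a ψ t = exteriorEnergy V xc 0 (fun s x => ψ (s + -a) x) (t + a) := by
  unfold exteriorEnergy
  have hset : {x : ℝ | a + |t| < |x - xc|} = {x : ℝ | 0 + |t + a| < |x - xc|} := by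
    ext x
    simp only [mem_setOf_eq]
    rw [abs_of_nonneg ht, abs_of_nonneg hta]
    constructor <;> intro h <;> linarith
  rw [hset]
  refine lintegral_congr fun x => ?_
  unfold energyDensity
  rw [deriv_comp_add_const (fun τ => ψ τ x) (-a) (t + a)]
  simp

/-- Exterior energies of a solution are non-increasing on `t ≥ max 0 (−a)` for EVERY aperture `a`
(negative, i.e. lagged, apertures included). -/
theorem exteriorEnergy_antitoneOn_tail (hV : Differentiable ℝ V) (hV0 : ∀ x, 0 ≤ V x)
    (hψ : IsSolution V ψ) (xc a : ℝ) :
    AntitoneOn (exteriorEnergy V xc a ψ) (Ici (max 0 (-a))) := by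
  intro t₁ ht₁ t₂ ht₂ h12
  simp only [mem_Ici, max_le_iff] at ht₁ ht₂
  rw [exteriorEnergy_eq_tshift V xc ht₁.1 (by linarith) ψ,
    exteriorEnergy_eq_tshift V xc ht₂.1 (by linarith) ψ]
  exact (RW.exteriorEnergy_antitoneOn hV hV0 (isSolution_tshift hψ (-a)) xc le_rfl).1
    (by simp only [mem_Ici]; linarith) (by simp only [mem_Ici]; linarith) (by linarith)

/-- **Convergence forward**: the exterior energy tends to the forward channel energy. -/
theorem tendsto_exteriorEnergy_atTop (hV : Differentiable ℝ V) (hV0 : ∀ x, 0 ≤ V x)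
    (hψ : IsSolution V ψ) (xc a : ℝ) :
    Tendsto (exteriorEnergy V xc a ψ) atTop (𝓝 (channelEnergy V xc a ψ atTop)) := by
  set T₀ : ℝ := max 0 (-a) with hT₀
  have hanti := exteriorEnergy_antitoneOn_tail hV hV0 hψ xc a
  set g : ℝ → ℝ≥0∞ := fun t => exteriorEnergy V xc a ψ (max t T₀) with hg_def
  have hg : Antitone g := fun t t' htt' =>
    hanti (mem_Ici.2 (le_max_right t T₀)) (mem_Ici.2 (le_max_right t' T₀))
      (max_le_max htt' le_rfl)
  have heq : g =ᶠ[atTop] exteriorEnergy V xc a ψ := by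
    filter_upwards [eventually_ge_atTop T₀] with t ht
    simp [hg_def, max_eq_left ht]
  have hlimE : Tendsto (exteriorEnergy V xc a ψ) atTop (𝓝 (⨅ t, g t)) :=
    (tendsto_atTop_iInf hg).congr' heq
  have hch : channelEnergy V xc a ψ atTop = ⨅ t, g t := hlimE.liminf_eq
  rw [hch]
  exact hlimE

/-- Time reversal of exterior energies: `E_a[ψ(−·)](t) = E_a[ψ](−t)`. -/
theorem exteriorEnergy_reflect (hψ : ContDiff ℝ 2 (Function.uncurry ψ)) (xc a t : ℝ) :
    exteriorEnergy V xc a (fun t x => 0 * ψ t x + 1 * ψ (-t) x) t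
      = exteriorEnergy V xc a ψ (-t) := by
  unfold exteriorEnergy
  rw [abs_neg]
  refine lintegral_congr fun x => ?_
  rw [energyDensity_comb hψ]
  unfold energyDensity
  congr 1
  ring

/-- **Convergence backward**: the exterior energy tends to the backward channel energy. -/
theorem tendsto_exteriorEnergy_atBot (hV : Differentiable ℝ V) (hV0 : ∀ x, 0 ≤ V x)
    (hψ : IsSolution V ψ) (xc a : ℝ) :
    Tendsto (exteriorEnergy V xc a ψ) atBot (𝓝 (channelEnergy V xc a ψ atBot)) := by
  have h := tendsto_exteriorEnergy_atTop hV hV0 (isSolution_comb hψ 0 1) xc a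
  have hfun : exteriorEnergy V xc a ψ
      = exteriorEnergy V xc a (fun t x => 0 * ψ t x + 1 * ψ (-t) x) ∘ Neg.neg := by
    funext t
    rw [Function.comp_apply, exteriorEnergy_reflect hψ.1, neg_neg]
  have hch : channelEnergy V xc a ψ atBot
      = channelEnergy V xc a (fun t x => 0 * ψ t x + 1 * ψ (-t) x) atTop := by
    unfold channelEnergy
    rw [hfun, Filter.liminf_comp, Filter.map_neg_atBot]
  rw [hch, hfun]
  exact h.comp tendsto_neg_atBot_atTop

/-- **Channel form of the parity split**: `ch⁺(ψ) + ch⁻(ψ) = 2ch⁺(ψ_e) + 2ch⁺(ψ_o)` for every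
aperture. -/
theorem channel_parity_split (hV : Differentiable ℝ V) (hV0 : ∀ x, 0 ≤ V x)
    (hψ : IsSolution V ψ) (xc a : ℝ) :
    channelEnergy V xc a ψ atTop + channelEnergy V xc a ψ atBot
      = 2 * channelEnergy V xc a (fun t x => 2⁻¹ * ψ t x + 2⁻¹ * ψ (-t) x) atTop
        + 2 * channelEnergy V xc a (fun t x => 2⁻¹ * ψ t x + -2⁻¹ * ψ (-t) x) atTop := by
  have h1 := tendsto_exteriorEnergy_atTop hV hV0 hψ xc a
  have h2 := (tendsto_exteriorEnergy_atBot hV hV0 hψ xc a).comp tendsto_neg_atTop_atBot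
  have he := tendsto_exteriorEnergy_atTop hV hV0 (isSolution_comb hψ 2⁻¹ 2⁻¹) xc a
  have ho := tendsto_exteriorEnergy_atTop hV hV0 (isSolution_comb hψ 2⁻¹ (-2⁻¹)) xc a
  refine tendsto_nhds_unique ?_
    ((ENNReal.Tendsto.const_mul he (Or.inr (by simp))).add
      (ENNReal.Tendsto.const_mul ho (Or.inr (by simp))))
  exact (h1.add h2).congr fun t => exteriorEnergy_parity_split hV.continuous hV0 hψ.1 xc a t

/-- Channel energies are monotone in the aperture (a smaller aperture sees more energy). -/
theorem channelEnergy_mono_aperture (V : ℝ → ℝ) (xc : ℝ) {ρ ρ' : ℝ} (hρ : ρ' ≤ ρ)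
    (ψ : ℝ → ℝ → ℝ) (l : Filter ℝ) :
    channelEnergy V xc ρ ψ l ≤ channelEnergy V xc ρ' ψ l := by
  refine Filter.liminf_le_liminf (Eventually.of_forall fun t => ?_)
  unfold exteriorEnergy
  refine lintegral_mono_set fun x hx => ?_
  simp only [mem_setOf_eq] at hx ⊢
  linarith

end Channels

end Parity

/-- REDUCTION (parity regrading; ideator 3's `parityTransfer_mpr`, kernel-checked in
`Cruxes/WindowedShellChannels/SketchIdeator3.lean`): exterior energies converge for every (lagged) aperture, time
reversal ⊗ parallelogram law give `ch⁺(ψ) + ch⁻(ψ) = 2ch⁺(ψ_even) + 2ch⁺(ψ_odd)` and `E(ψ) = E(ψ_even) + E(ψ_odd)` at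
`t = 0`, the even/odd parts of an RW solution are RW solutions with data `(ψ₀,0)` / `(0,ψ₁)` still supported off the
shell; constants `h := max h_e h_o`, `c := 2 min c_e c_o`. -/
theorem stub_parity
    (He : ∀ M : ℝ, 0 < M → ∀ ρ : ℝ, 0 < ρ → ∃ h : ℝ, 0 ≤ h ∧ ∃ c : ℝ, 0 < c ∧ ∀ (r : ℝ → ℝ) (xc : ℝ),
        IsTortoiseRadius M r xc → ∀ (s ℓ : ℕ), s ≤ 2 → s ≤ ℓ → ∀ ψ : ℝ → ℝ → ℝ,
          IsRWSolution M s ℓ r ψ → (∀ t x, ψ (-t) x = ψ t x) →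
          CauchyDataSupportedOn ψ {x : ℝ | ρ < |x - xc|} →
            ENNReal.ofReal c * totalEnergy (linePotential M s ℓ r) ψ 0 ≤
              channelEnergy (linePotential M s ℓ r) xc (ρ - h) ψ atTop)
    (Ho : ∀ M : ℝ, 0 < M → ∀ ρ : ℝ, 0 < ρ → ∃ h : ℝ, 0 ≤ h ∧ ∃ c : ℝ, 0 < c ∧ ∀ (r : ℝ → ℝ) (xc : ℝ),
        IsTortoiseRadius M r xc → ∀ (s ℓ : ℕ), s ≤ 2 → s ≤ ℓ → ∀ ψ : ℝ → ℝ → ℝ,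
          IsRWSolution M s ℓ r ψ → (∀ t x, ψ (-t) x = -ψ t x) →
          CauchyDataSupportedOn ψ {x : ℝ | ρ < |x - xc|} →
            ENNReal.ofReal c * totalEnergy (linePotential M s ℓ r) ψ 0 ≤
              channelEnergy (linePotential M s ℓ r) xc (ρ - h) ψ atTop) :
    WindowedShellChannels := by
  intro M hM ρ hρ
  obtain ⟨h₁, hh₁, c₁, hc₁, H₁⟩ := He M hM ρ hρ
  obtain ⟨h₂, hh₂, c₂, hc₂, H₂⟩ := Ho M hM ρ hρ
  refine ⟨max h₁ h₂, le_trans hh₁ (le_max_left _ _), 2 * min c₁ c₂, by positivity, ?_⟩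
  intro r xc hr s ℓ hs hsℓ ψ hψ hsupp
  have hV : Differentiable ℝ (linePotential M s ℓ r) := RW.differentiable_linePotential hr s ℓ
  have hV0 : ∀ x, 0 ≤ linePotential M s ℓ r x := fun x => (RW.linePotential_pos hr hsℓ x).le
  have heven : ∀ t x, 2⁻¹ * ψ (-t) x + 2⁻¹ * ψ (- -t) x = 2⁻¹ * ψ t x + 2⁻¹ * ψ (-t) x := by
    intro t x; rw [neg_neg, add_comm]
  have hodd : ∀ t x,
      2⁻¹ * ψ (-t) x + -2⁻¹ * ψ (- -t) x = -(2⁻¹ * ψ t x + -2⁻¹ * ψ (-t) x) := by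
    intro t x; rw [neg_neg]; ring
  have K₁ := (H₁ r xc hr s ℓ hs hsℓ _ (Parity.isSolution_comb hψ 2⁻¹ 2⁻¹) heven
    (Parity.supported_comb hψ.1 hsupp _ _)).trans (Parity.channelEnergy_mono_aperture _ xc
      (show ρ - max h₁ h₂ ≤ ρ - h₁ by linarith [le_max_left h₁ h₂]) _ atTop)
  have K₂ := (H₂ r xc hr s ℓ hs hsℓ _ (Parity.isSolution_comb hψ 2⁻¹ (-2⁻¹)) hodd
    (Parity.supported_comb hψ.1 hsupp _ _)).trans (Parity.channelEnergy_mono_aperture _ xc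
      (show ρ - max h₁ h₂ ≤ ρ - h₂ by linarith [le_max_right h₁ h₂]) _ atTop)
  have hc1 : ENNReal.ofReal (min c₁ c₂) ≤ ENNReal.ofReal c₁ :=
    ENNReal.ofReal_le_ofReal (min_le_left _ _)
  have hc2 : ENNReal.ofReal (min c₁ c₂) ≤ ENNReal.ofReal c₂ :=
    ENNReal.ofReal_le_ofReal (min_le_right _ _)
  rw [Parity.channel_parity_split hV hV0 hψ xc (ρ - max h₁ h₂),
    Parity.totalEnergy_zero_split hV.continuous hV0 hψ.1, ENNReal.ofReal_mul zero_le_two,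
    ENNReal.ofReal_ofNat, mul_add, mul_assoc, mul_assoc]
  exact add_le_add (mul_le_mul_right ((mul_le_mul_left hc1 _).trans K₁) 2)
    (mul_le_mul_right ((mul_le_mul_left hc2 _).trans K₂) 2)

end Summit.FinalStateConjecture.FinalStateConjecture.Theorems.WindowedShellChannelsStubs

end
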